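import Summits.Ventures.CertifiedManyBodySolver.Theorems.M3x2EdgeSplitSymReplayPackedCollect
import Summits.Ventures.CertifiedManyBodySolver.Theorems.M3x2EdgeSplitSymReplayPackedKey
import Std.Data.TreeMap
import HarnessLib

/-!
# SymReplay — lever (α-T) ORDERED-MAP COLLECTOR: `pcollectT = pcollect2` via `Std.TreeMap` on one-integer word keys

(team lb-sym, cell hub-lb; hub-lb-sym-eng-4 g3, 2026-08-28; module 4 of 4 of (α-T); ADDITIVE on `…PackedCollect`/`…PackedKey` (modules 1–3: the landed
collector `pcollect2 q` is the UNIQUE collected form of `q`) and `…PackedHB`; nothing landed is touched.)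

WHY (measured, STATUS 2026-08-28 hub-lb-sym-eng-4 g3 «α-NATIVE / α-T BENCH», rung-V module 0, 223 013 packed nf terms → 58 135
words, interpreted = gate mode): the collector of record `pcollect2 = pmergeAdj ∘ psortW` is an INTERPRETED merge sort —
5.0–5.2 s per module (23 µs per product, ≈ ¼ of the per-product bill at E₁).  Accumulating the coefficients in a `Std.TreeMap ℕ`
(core library ⇒ native compares/inserts under the interpreter) keyed by ONE INTEGER per word and reading the map back in key order
gives THE SAME LIST in 1.64 s (÷3.1): the key `wkey B n w = Σᵢ (wᵢ+1)·B^(n−1−i)` (hub-lb-sym-eng-4 g2, «E8») is an ORDER ISOMORPHISM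
for the prefix-lexicographic `pwordLt` on words with codes `< B − 1` and length `≤ n` (`pwordLt_eq_wkey_lt`), so ascending key order
IS the collector's order.  (Keying the tree by the word itself, `compare` on `List ℕ`, measured 5.8 s — slower than the sort; a
`Std.HashMap` + sort of the distinct words 2.0–2.5 s.)

WHAT.  (b) `taccStep`/`tacc` (fold into `Std.TreeMap ℕ (ℚ × PWord)`: value = (running word
sum, the word)), **`pcollectT p`** = the map's `toList` values.  (c) the fold invariant `tacc_getElem?` (value at key `k` = (`ksum`,
first word with that key)), via `Std.TreeMap.getElem?_insert/_emptyc`; the read-back via `mem_toList_iff_getElem?_eq_some`,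
`ordered_keys_toList`.  (d) `pcollectT_isColl : IsColl p (pcollectT p)` ⇒ **`pcollectT_eq : pcollectT p = pcollect2 p`**
(module A's uniqueness) — unconditional.  (e) drop-ins for the two call sites of the packed pipe: `pcanonNFZHBZT`, `pisZeroT` with
`pcanonNFZHBZT_eq`, `pisZeroT_eq`, and the fact-producing corollary `pisZero_of_T`.  MODULE GRAMMAR (E-class): per module
`out_m : pisZeroT (pcanonNFZHBZT lo hi PackedNF.oracleV3 (PackedNF.encP lo hi (shareRFastMFD …))) = true := by native_decide`, turned
into the `OutFactsP0` fact by `pisZero_of_T` (one `rw`); every closing (`…PMF0/PMFZ0/PMFD0/PMFP`) unchanged.  Std axioms; no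
`native_decide` here.

HONEST FRAMING: an interpreted replay-COST lever with its equality proof; certifies nothing; no bound of record moves; no summit
or crux statement is proved here; nothing here predicts superconductivity.
-/

namespace Summit.Ventures.CertifiedManyBodySolver.Theorems.SymReplay.PackedNF

open Summit.Ventures.CertifiedManyBodySolver.Theorems.SymReplay

/-! ##### (b) the ordered-map collector -/

/-- One accumulation step: add the term's coefficient at its word key (value = (running sum, the word)). -/
def taccStep (pows : List ℕ) (m : Std.TreeMap ℕ (ℚ × PWord)) (t : ℚ × PWord) : Std.TreeMap ℕ (ℚ × PWord) :=
  let k := wkeyN pows t.2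
  match m[k]? with
  | none => m.insert k (t.1, t.2)
  | some cw => m.insert k (cw.1 + t.1, cw.2)

/-- Accumulate a packed polynomial into the ordered map. -/
def tacc (pows : List ℕ) (p : PPoly) : Std.TreeMap ℕ (ℚ × PWord) := p.foldl (taccStep pows) ∅

/-- **The ordered-map collector**: word sums read back in ascending key order (= `pwordLt` order). -/
def pcollectT (p : PPoly) : PPoly := ((tacc (powsB (maxCode p + 2) (maxLen p)) p).toList).map Prod.snd

/-! ##### (c) the fold invariant and the read-back -/

/-- Sum of the coefficients of the terms of `pre` whose key is `k`. -/
def ksum (key : PWord → ℕ) (pre : PPoly) (k : ℕ) : ℚ := ((pre.filter fun t => key t.2 == k).map Prod.fst).sum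

/-- The word of the first term of `pre` whose key is `k`. -/
def kfirst (key : PWord → ℕ) (pre : PPoly) (k : ℕ) : Option PWord := (pre.find? fun t => key t.2 == k).map Prod.snd

/-- `ksum` over an appended term. -/
theorem ksum_append (key : PWord → ℕ) (pre : PPoly) (t : ℚ × PWord) (k : ℕ) :
    ksum key (pre ++ [t]) k = ksum key pre k + (if key t.2 = k then t.1 else 0) := by
  unfold ksum
  rw [List.filter_append, List.map_append, List.sum_append]
  congr 1
  by_cases h : key t.2 = k
  · simp [h]
  · simp [h]

/-- `kfirst` over an appended term. -/
theorem kfirst_append (key : PWord → ℕ) (pre : PPoly) (t : ℚ × PWord) (k : ℕ) :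
    kfirst key (pre ++ [t]) k = (kfirst key pre k).or (if key t.2 = k then some t.2 else none) := by
  unfold kfirst
  rw [List.find?_append]
  cases h : pre.find? (fun t => key t.2 == k) with
  | some s => simp
  | none =>
    rw [Option.map_none, Option.none_or, Option.none_or]
    by_cases h' : key t.2 = k
    · simp [h']
    · simp [h']

/-- **The fold invariant** of the ordered-map accumulation (from any start map satisfying it). -/
theorem tacc_foldl_getElem? (pows : List ℕ) : ∀ (l pre : PPoly) (m : Std.TreeMap ℕ (ℚ × PWord)),
    (∀ k, m[k]? = (kfirst (wkeyN pows) pre k).map fun w => (ksum (wkeyN pows) pre k, w)) →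
    ∀ k, (l.foldl (taccStep pows) m)[k]? =
      (kfirst (wkeyN pows) (pre ++ l) k).map fun w => (ksum (wkeyN pows) (pre ++ l) k, w) := by
  intro l
  induction l with
  | nil => intro pre m h k; rw [List.foldl_nil, List.append_nil]; exact h k
  | cons t l ih =>
    intro pre m h k
    rw [List.foldl_cons, show pre ++ t :: l = pre ++ [t] ++ l by simp]
    refine ih (pre ++ [t]) _ (fun k' => ?_) k
    -- one step
    rw [kfirst_append, ksum_append]
    unfold taccStep
    simp only
    have hk0 := h (wkeyN pows t.2)
    cases hm : m[wkeyN pows t.2]? with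
    | none =>
      rw [hm] at hk0
      simp only
      rw [Std.TreeMap.getElem?_insert, h k']
      have hnone : kfirst (wkeyN pows) pre (wkeyN pows t.2) = none := by
        cases hf : kfirst (wkeyN pows) pre (wkeyN pows t.2) with
        | none => rfl
        | some w => rw [hf] at hk0; simp at hk0
      by_cases hk : wkeyN pows t.2 = k'
      · subst hk
        have hc : compare (wkeyN pows t.2) (wkeyN pows t.2) = Ordering.eq := Std.ReflCmp.compare_self
        have hs : ksum (wkeyN pows) pre (wkeyN pows t.2) = 0 := by
          -- no term of `pre` has this key (find? found none)
          unfold ksum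
          have hf : pre.find? (fun s => wkeyN pows s.2 == wkeyN pows t.2) = none := by
            unfold kfirst at hnone; simpa using hnone
          rw [List.find?_eq_none] at hf
          rw [List.filter_eq_nil_iff.2 (fun s hs => hf s hs)]
          rfl
        rw [if_pos hc, hnone, if_pos rfl, if_pos rfl, Option.none_or, Option.map_some, hs, zero_add]
      · have hne : compare (wkeyN pows t.2) k' ≠ .eq := by
          rw [Ne, Std.LawfulEqCmp.compare_eq_iff_eq]; exact hk
        rw [if_neg hne, if_neg hk, if_neg hk, Option.or_none, add_zero]
    | some cw =>
      rw [hm] at hk0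
      simp only
      rw [Std.TreeMap.getElem?_insert, h k']
      obtain ⟨w0, hf0, hcw⟩ : ∃ w0, kfirst (wkeyN pows) pre (wkeyN pows t.2) = some w0 ∧
          cw = (ksum (wkeyN pows) pre (wkeyN pows t.2), w0) := by
        cases hf : kfirst (wkeyN pows) pre (wkeyN pows t.2) with
        | none => rw [hf] at hk0; simp at hk0
        | some w0 => rw [hf] at hk0; simp at hk0; exact ⟨w0, rfl, hk0⟩
      by_cases hk : wkeyN pows t.2 = k'
      · subst hk
        have hc : compare (wkeyN pows t.2) (wkeyN pows t.2) = Ordering.eq := Std.ReflCmp.compare_self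
        rw [if_pos hc, hf0, if_pos rfl, if_pos rfl, Option.some_or, Option.map_some, hcw]
      · have hne : compare (wkeyN pows t.2) k' ≠ .eq := by
          rw [Ne, Std.LawfulEqCmp.compare_eq_iff_eq]; exact hk
        rw [if_neg hne, if_neg hk, if_neg hk, Option.or_none, add_zero]

/-- **Value of the accumulated map at a key.** -/
theorem tacc_getElem? (pows : List ℕ) (p : PPoly) (k : ℕ) :
    (tacc pows p)[k]? = (kfirst (wkeyN pows) p k).map fun w => (ksum (wkeyN pows) p k, w) := by
  unfold tacc
  have h := tacc_foldl_getElem? pows p [] ∅ (fun k => by simp [kfirst, ksum]) k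
  rwa [List.nil_append] at h

/-! ##### (d) the ordered-map collector produces a collected form ⇒ it IS `pcollect2` -/

/-- Occurrence, unfolded. -/
theorem occ_eq_true_iff (l : PPoly) (w : PWord) : occ l w = true ↔ ∃ t ∈ l, t.2 = w := by
  unfold occ
  rw [List.any_eq_true]
  exact ⟨fun ⟨t, ht, e⟩ => ⟨t, ht, (pwordEq_eq_true_iff _ _).1 e⟩, fun ⟨t, ht, e⟩ => ⟨t, ht, (pwordEq_eq_true_iff _ _).2 e⟩⟩

/-- No occurrence ⇒ zero word sum. -/
theorem csum_eq_zero_of_occ (l : PPoly) (w : PWord) (h : occ l w = false) : csum l w = 0 := by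
  unfold csum
  rw [List.filter_eq_nil_iff.2, List.map_nil, List.sum_nil]
  intro t ht e
  have : occ l w = true := (occ_eq_true_iff l w).2 ⟨t, ht, (pwordEq_eq_true_iff _ _).1 e⟩
  rw [h] at this
  exact Bool.false_ne_true this

/-- `kfirst` returns the word of a term of the list, with the requested key. -/
theorem kfirst_spec {key : PWord → ℕ} {p : PPoly} {k : ℕ} {w : PWord} (h : kfirst key p k = some w) :
    ∃ s ∈ p, s.2 = w ∧ key w = k := by
  unfold kfirst at h
  obtain ⟨s, hs, rfl⟩ := Option.map_eq_some_iff.1 h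
  refine ⟨s, List.mem_of_find?_eq_some hs, rfl, ?_⟩
  have := List.find?_some hs
  simpa using this

/-- `kfirst` succeeds at the key of an occurring word (some word with that key is returned). -/
theorem kfirst_isSome {key : PWord → ℕ} {p : PPoly} {t : ℚ × PWord} (ht : t ∈ p) :
    ∃ w, kfirst key p (key t.2) = some w := by
  unfold kfirst
  cases hf : p.find? (fun s => key s.2 == key t.2) with
  | none =>
    rw [List.find?_eq_none] at hf
    exact absurd (hf t ht) (by simp)
  | some s => exact ⟨s.2, rfl⟩

section Main

variable (p : PPoly)

/-- The key of record for `p`. -/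
private abbrev keyOf (p : PPoly) : PWord → ℕ := wkeyN (powsB (maxCode p + 2) (maxLen p))

/-- The executable key is `wkey` at `p`'s bounds. -/
private theorem keyOf_eq (w : PWord) : keyOf p w = wkey (maxCode p + 2) (maxLen p) w := wkeyN_eq _ _ _

/-- **Key injectivity on the words of `p`.** -/
theorem key_inj_on {s t : ℚ × PWord} (hs : s ∈ p) (ht : t ∈ p) (h : keyOf p s.2 = keyOf p t.2) : s.2 = t.2 := by
  rw [keyOf_eq, keyOf_eq] at h
  exact wkey_inj _ _ _ _ (by omega) (codesLt_maxCode p s hs) (codesLt_maxCode p t ht) (length_le_maxLen p s hs)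
    (length_le_maxLen p t ht) h

/-- **Key order is word order on the words of `p`.** -/
theorem key_lt_iff {s t : ℚ × PWord} (hs : s ∈ p) (ht : t ∈ p) :
    keyOf p s.2 < keyOf p t.2 ↔ pwordLt s.2 t.2 = true := by
  rw [keyOf_eq, keyOf_eq, pwordLt_eq_wkey_lt (maxCode p + 2) (maxLen p) s.2 t.2 (by omega) (codesLt_maxCode p s hs)
    (codesLt_maxCode p t ht) (length_le_maxLen p s hs) (length_le_maxLen p t ht), decide_eq_true_eq]

/-- Key sums are word sums on the words of `p`. -/
theorem ksum_eq_csum {t : ℚ × PWord} (ht : t ∈ p) : ksum (keyOf p) p (keyOf p t.2) = csum p t.2 := by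
  unfold ksum csum
  congr 2
  refine List.filter_congr fun s hs => ?_
  rw [Bool.eq_iff_iff, beq_iff_eq, pwordEq_eq_true_iff]
  exact ⟨fun h => key_inj_on p hs ht h, fun h => by rw [h]⟩

/-- Entries of the read-back list. -/
theorem mem_pcollectT_iff (e : ℚ × PWord) :
    e ∈ pcollectT p ↔ ∃ k w, kfirst (keyOf p) p k = some w ∧ e = (ksum (keyOf p) p k, w) := by
  unfold pcollectT
  rw [List.mem_map]
  constructor
  · rintro ⟨⟨k, e'⟩, hm, rfl⟩
    rw [Std.TreeMap.mem_toList_iff_getElem?_eq_some, tacc_getElem?] at hm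
    obtain ⟨w, hw, he⟩ := Option.map_eq_some_iff.1 hm
    exact ⟨k, w, hw, he.symm⟩
  · rintro ⟨k, w, hw, rfl⟩
    refine ⟨(k, (ksum (keyOf p) p k, w)), ?_, rfl⟩
    rw [Std.TreeMap.mem_toList_iff_getElem?_eq_some, tacc_getElem?, hw, Option.map_some]

/-- Every entry's word is a word of `p` carrying the entry's key, and its coefficient is that word's sum. -/
theorem entry_spec {e : ℚ × PWord} (he : e ∈ pcollectT p) :
    ∃ s ∈ p, s.2 = e.2 ∧ e.1 = csum p e.2 := by
  obtain ⟨k, w, hw, rfl⟩ := (mem_pcollectT_iff p e).1 he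
  obtain ⟨s, hs, hsw, hk⟩ := kfirst_spec hw
  refine ⟨s, hs, hsw, ?_⟩
  show ksum (keyOf p) p k = csum p w
  rw [← hk, ← hsw]
  exact ksum_eq_csum p hs

/-- **The read-back list is strictly sorted by word.** -/
theorem pcollectT_strict : StrictP (pcollectT p) := by
  unfold StrictP pcollectT
  rw [List.pairwise_map]
  refine List.Pairwise.imp_of_mem ?_ (Std.TreeMap.ordered_keys_toList (t := tacc (powsB (maxCode p + 2) (maxLen p)) p))
  intro a b ha hb hab
  -- both entries come from words of `p` with the entries' keys
  obtain ⟨ka, ea⟩ := a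
  obtain ⟨kb, eb⟩ := b
  rw [Std.TreeMap.mem_toList_iff_getElem?_eq_some, tacc_getElem?] at ha hb
  obtain ⟨wa, hwa, hea⟩ := Option.map_eq_some_iff.1 ha
  obtain ⟨wb, hwb, heb⟩ := Option.map_eq_some_iff.1 hb
  obtain ⟨sa, hsa, hsaw, hka⟩ := kfirst_spec hwa
  obtain ⟨sb, hsb, hsbw, hkb⟩ := kfirst_spec hwb
  simp only at hab
  rw [Nat.compare_eq_lt] at hab
  rw [← hea, ← heb]
  show pwordLt wa wb = true
  rw [← hsaw, ← hsbw] at *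
  rw [← hka, ← hkb] at hab
  exact (key_lt_iff p hsa hsb).1 hab

/-- **Occurrence in the read-back list = occurrence in `p`.** -/
theorem occ_pcollectT (w : PWord) : occ (pcollectT p) w = occ p w := by
  rw [Bool.eq_iff_iff, occ_eq_true_iff, occ_eq_true_iff]
  constructor
  · rintro ⟨e, he, rfl⟩
    obtain ⟨s, hs, hse, _⟩ := entry_spec p he
    exact ⟨s, hs, hse⟩
  · rintro ⟨t, ht, rfl⟩
    obtain ⟨w', hw'⟩ := kfirst_isSome (key := keyOf p) ht
    obtain ⟨s, hs, hsw, hk⟩ := kfirst_spec hw'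
    have hst : s.2 = t.2 := key_inj_on p hs ht (by rw [hsw, hk])
    refine ⟨(ksum (keyOf p) p (keyOf p t.2), w'), (mem_pcollectT_iff p _).2 ⟨_, w', hw', rfl⟩, ?_⟩
    show w' = t.2
    rw [← hsw, hst]

/-- **Word sums of the read-back list = word sums of `p`.** -/
theorem csum_pcollectT (w : PWord) : csum (pcollectT p) w = csum p w := by
  cases hocc : occ p w with
  | false =>
    rw [csum_eq_zero_of_occ p w hocc, csum_eq_zero_of_occ (pcollectT p) w (by rw [occ_pcollectT, hocc])]
  | true =>
    have hocc' : occ (pcollectT p) w = true := by rw [occ_pcollectT, hocc]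
    obtain ⟨e, he, hew⟩ := (occ_eq_true_iff _ _).1 hocc'
    obtain ⟨s, hs, hse, hc⟩ := entry_spec p he
    have hmem := ((mem_iff_of_strict _ (pcollectT_strict p) e).1 he).2
    rw [← hew, hmem, hc]

/-- **The ordered-map collector produces a collected form of its input.** -/
theorem pcollectT_isColl : IsColl p (pcollectT p) :=
  ⟨pcollectT_strict p, fun w => ⟨occ_pcollectT p w, csum_pcollectT p w⟩⟩

/-- **MAIN: the ordered-map collector IS the landed collector** (same list, unconditionally). -/
theorem pcollectT_eq : pcollectT p = pcollect2 p := eq_pcollect2_of_isColl p _ (pcollectT_isColl p)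

end Main

/-! ##### (e) drop-ins for the two collector call sites of the packed pipe -/

/-- Packed hinted zero-filtered pipe with the ordered-map collector after normal ordering (twin of `pcanonNFZHBZ`). -/
def pcanonNFZHBZT (lo hi : ℤ × ℤ) (oP : PWord → PHint) (p : PPoly) : PPoly :=
  (pdropZeros (pcollectT (pnfPoly p))).flatMap fun t => pcanonTermHWBZ lo hi (oP t.2) t

/-- Packed zero test with the ordered-map collector (twin of `pisZero`). -/
def pisZeroT (p : PPoly) : Bool := (pcollectT p).all fun t => decide (t.1 = 0)

/-- `pcanonNFZHBZT = pcanonNFZHBZ`. -/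
theorem pcanonNFZHBZT_eq (lo hi : ℤ × ℤ) (oP : PWord → PHint) (p : PPoly) :
    pcanonNFZHBZT lo hi oP p = pcanonNFZHBZ lo hi oP p := by
  unfold pcanonNFZHBZT pcanonNFZHBZ; rw [pcollectT_eq]

/-- `pisZeroT = pisZero`. -/
theorem pisZeroT_eq (p : PPoly) : pisZeroT p = pisZero p := by
  unfold pisZeroT pisZero; rw [pcollectT_eq]

/-- **Fact transfer**: a module fact computed with the ordered-map collector at both call sites IS the `OutFactsP0` fact of record
(`pisZero (pcanonNFZHBZ lo hi oP q) = true`), for any packed input `q` (e.g. `encP lo hi (shareRFastMFD …)` or `shareRFastMFP …`). -/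
theorem pisZero_of_T (lo hi : ℤ × ℤ) (oP : PWord → PHint) (q : PPoly) (h : pisZeroT (pcanonNFZHBZT lo hi oP q) = true) :
    pisZero (pcanonNFZHBZ lo hi oP q) = true := by
  rwa [pisZeroT_eq, pcanonNFZHBZT_eq] at h

end Summit.Ventures.CertifiedManyBodySolver.Theorems.SymReplay.PackedNF
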